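import Summits.NavierStokesRegularity.NavierStokesRegularity.Theses.SlicedKelvin
import Summits.NavierStokesRegularity.NavierStokesRegularity.Theorems.SlicedKelvinPlanarFluxAPrioriHeatKernelDomination

/-!
# Strategist census sketch (seat s2; tree path `Cruxes/PlanarFluxAPriori/StrategyCensusS2.lean`) — crux `SlicedKelvin.PlanarFluxAPriori` (stmt-NavierStokesRegularity-15600)

Typed forms of the language switches attempted in `STRATEGY-CENSUS.md` (crux-strategist seat
`planner-cstrat-stmt-NavierStokesRegularity-15600-s2-0`, 2026-08-17). Every `theorem` below is
sorry-free LOGIC (glue of a candidate decomposition, or a reduction between candidate pieces);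
every `def … : Prop` is a candidate piece / strengthening / obstruction. Nothing here is filed as a
route item or registered as a line: the census explains, piece by piece, why none of these cuts
gives leverage on the crux short of the summit-level problems they expose (no Type-II blow-up in the
vorticity-Morrey sense; Liouville at bounded Giga–Miyakawa density).

Sections: §1 rate split (D6) · §2 direction split (D4) · §3 lifespan split (D5) · §4 the lead's
nodal reshape typed (D7) · §5 negation-side obstruction and the reduction of D6's Type-I piece to
(R_G)+(L_G) · §6 strengthenings.
-/

noncomputable section

set_option linter.dupNamespace false
set_option linter.unusedVariables false

namespace Summit.NavierStokesRegularity.NavierStokesRegularity.Cruxes.PlanarFluxAPriori.StrategistS2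

open MeasureTheory Set Filter Literature.Analysis.FluidPDE
open scoped ENNReal Topology

/-- `ℝ³`. -/
abbrev E3 := EuclideanSpace ℝ (Fin 3)
/-- `ℝ²` (plane chart). -/
abbrev E2 := EuclideanSpace ℝ (Fin 2)

/-- Unsigned planar vorticity flux of `v` through the plane `R{x₂ = c}` — verbatim the crux integrand. -/
abbrev pflux (v : E3 → E3) (R : E3 ≃ₗᵢ[ℝ] E3) (c : ℝ) : ℝ≥0∞ :=
  ∫⁻ y : E2, ‖inner ℝ (curl v (R (WithLp.toLp 2 ![y 0, y 1, c]))) (R (EuclideanSpace.single 2 1))‖ₑ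

/-- Readback: the crux, restated with `pflux`, is the route decl by `Iff.rfl`. -/
example : Theses.SlicedKelvin.PlanarFluxAPriori ↔
    ∀ (ν T : ℝ), 0 < ν → 0 < T → ∀ (u : ℝ → E3 → E3) (p : ℝ → E3 → ℝ),
      IsClassicalNSSolutionOn (Ico 0 T) ν 0 u p → IsLerayHopfOn T ν 0 (u 0) u →
      HasRapidSpatialDecay (u 0) →
      ∃ M : ℝ, ∀ t ∈ Ico 0 T, ∀ (R : E3 ≃ₗᵢ[ℝ] E3) (c : ℝ), pflux (u t) R c ≤ ENNReal.ofReal M :=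
  Iff.rfl

/-! ## §1 Rate split (D6): crux ⇔ MorreyTypeI ∧ TypeIFluxBound (lossless modulo kinematic slicing) -/

/-- Giga–Miyakawa (vorticity-Morrey) bound `∫_{B_r(x)} |curl u(t)| ≤ 𝔐 r` for all balls and all
`t ∈ [0,T)` — "Type I in the Morrey sense" up to `T`. -/
def MorreyBoundOn (T : ℝ) (u : ℝ → E3 → E3) (𝔐 : ℝ) : Prop :=
  ∀ t ∈ Ico 0 T, ∀ (x : E3) (r : ℝ), 0 < r →
    ∫⁻ y in Metric.ball x r, ‖curl (u t) y‖ₑ ≤ ENNReal.ofReal (𝔐 * r)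

/-- D6 piece 1 — NO TYPE-II BLOW-UP, MORREY FORM: along every solution of the crux class the
Giga–Miyakawa density stays bounded up to `T`. A CONSEQUENCE of the crux (`morreyTypeI_of_planarFluxAPriori`). -/
def MorreyTypeI : Prop :=
  ∀ (ν T : ℝ), 0 < ν → 0 < T → ∀ (u : ℝ → E3 → E3) (p : ℝ → E3 → ℝ),
    IsClassicalNSSolutionOn (Ico 0 T) ν 0 u p → IsLerayHopfOn T ν 0 (u 0) u →
    HasRapidSpatialDecay (u 0) → ∃ 𝔐 : ℝ, MorreyBoundOn T u 𝔐

/-- D6 piece 2 — THE CRUX UNDER A MORREY TYPE-I BOUND. -/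
def TypeIFluxBound : Prop :=
  ∀ (ν T : ℝ), 0 < ν → 0 < T → ∀ (u : ℝ → E3 → E3) (p : ℝ → E3 → ℝ),
    IsClassicalNSSolutionOn (Ico 0 T) ν 0 u p → IsLerayHopfOn T ν 0 (u 0) u →
    HasRapidSpatialDecay (u 0) → (∃ 𝔐 : ℝ, MorreyBoundOn T u 𝔐) →
    ∃ M : ℝ, ∀ t ∈ Ico 0 T, ∀ (R : E3 ≃ₗᵢ[ℝ] E3) (c : ℝ), pflux (u t) R c ≤ ENNReal.ofReal M

/-- D6 glue (trivial seam): the two pieces give the crux BY NAME. -/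
theorem planarFluxAPriori_of_rateSplit (h₁ : MorreyTypeI) (h₂ : TypeIFluxBound) :
    Theses.SlicedKelvin.PlanarFluxAPriori := by
  intro ν T hν hT u p hcl hLH hdec
  exact h₂ ν T hν hT u p hcl hLH hdec (h₁ ν T hν hT u p hcl hLH hdec)

/-- KINEMATIC SLICING (the first half of the route support `FluxVelocityBound`, stmt-15604;
Constantin 1990 / Giga–Miyakawa 1989 folklore): flux `≤ Φ` through every plane ⇒
`∫_{B_r(x)} |curl v| ≤ 6 Φ r` (slice the ball by the three coordinate foliations of the frame).
Provable now; carried as a hypothesis here. -/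
def FluxBoundsMorrey : Prop :=
  ∀ (v : E3 → E3), ContDiff ℝ (⊤ : ℕ∞) v → ∀ Φ : ℝ, 0 ≤ Φ →
    (∀ (R : E3 ≃ₗᵢ[ℝ] E3) (c : ℝ), pflux v R c ≤ ENNReal.ofReal Φ) →
    ∀ (x : E3) (r : ℝ), 0 < r → ∫⁻ y in Metric.ball x r, ‖curl v y‖ₑ ≤ ENNReal.ofReal (6 * Φ * r)

/-- LOSSLESSNESS of D6: the crux implies its first piece (modulo kinematic slicing). Hence any
proof of `PlanarFluxAPriori` proves "no Type-II blow-up (Morrey form)". -/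
theorem morreyTypeI_of_planarFluxAPriori (hK : FluxBoundsMorrey)
    (h : Theses.SlicedKelvin.PlanarFluxAPriori) : MorreyTypeI := by
  intro ν T hν hT u p hcl hLH hdec
  obtain ⟨M, hM⟩ := h ν T hν hT u p hcl hLH hdec
  refine ⟨6 * max M 0, fun t ht x r hr => ?_⟩
  have hsmooth : ContDiff ℝ (⊤ : ℕ∞) (u t) := hcl.contDiff_velocity ht
  have hflux : ∀ (R : E3 ≃ₗᵢ[ℝ] E3) (c : ℝ), pflux (u t) R c ≤ ENNReal.ofReal (max M 0) :=
    fun R c => (hM t ht R c).trans (ENNReal.ofReal_le_ofReal (le_max_left _ _))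
  exact hK (u t) hsmooth (max M 0) (le_max_right _ _) hflux x r hr

/-! ## §2 Direction split (D4): per-direction bound + uniformisation over directions -/

/-- D4 piece 1: for each FIXED frame `R` the flux through the planes `R{x₂ = c}` is bounded on `[0,T)`
(bound allowed to depend on `R`). -/
def DirectionwiseFluxBound : Prop :=
  ∀ (ν T : ℝ), 0 < ν → 0 < T → ∀ (u : ℝ → E3 → E3) (p : ℝ → E3 → ℝ),
    IsClassicalNSSolutionOn (Ico 0 T) ν 0 u p → IsLerayHopfOn T ν 0 (u 0) u →
    HasRapidSpatialDecay (u 0) →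
    ∀ (R : E3 ≃ₗᵢ[ℝ] E3), ∃ M : ℝ, ∀ t ∈ Ico 0 T, ∀ c : ℝ, pflux (u t) R c ≤ ENNReal.ofReal M

/-- D4 piece 2: uniformisation of a direction-wise bound over the (compact) family of directions. -/
def DirectionUniformisation : Prop :=
  ∀ (ν T : ℝ), 0 < ν → 0 < T → ∀ (u : ℝ → E3 → E3) (p : ℝ → E3 → ℝ),
    IsClassicalNSSolutionOn (Ico 0 T) ν 0 u p → IsLerayHopfOn T ν 0 (u 0) u →
    HasRapidSpatialDecay (u 0) →
    (∀ (R : E3 ≃ₗᵢ[ℝ] E3), ∃ M : ℝ, ∀ t ∈ Ico 0 T, ∀ c : ℝ, pflux (u t) R c ≤ ENNReal.ofReal M) →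
    ∃ M : ℝ, ∀ t ∈ Ico 0 T, ∀ (R : E3 ≃ₗᵢ[ℝ] E3) (c : ℝ), pflux (u t) R c ≤ ENNReal.ofReal M

/-- D4 glue (trivial seam). -/
theorem planarFluxAPriori_of_directionSplit (h₁ : DirectionwiseFluxBound)
    (h₂ : DirectionUniformisation) : Theses.SlicedKelvin.PlanarFluxAPriori :=
  fun ν T hν hT u p hcl hLH hdec => h₂ ν T hν hT u p hcl hLH hdec (h₁ ν T hν hT u p hcl hLH hdec)

/-! ## §3 Lifespan split (D5): the crux lives at `T = T*` only -/

/-- D5 piece 1 (provable now from decay persistence THROUGH `T`, cf. landed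
`Theorems.SlicedKelvinPlanarFluxAPriori.stub_decayPersistence`): if the solution extends smoothly
past `T`, its planar flux is bounded on `[0,T)`. -/
def NoBlowupFlux : Prop :=
  ∀ (ν T : ℝ), 0 < ν → 0 < T → ∀ (u : ℝ → E3 → E3) (p : ℝ → E3 → ℝ),
    IsClassicalNSSolutionOn (Ico 0 T) ν 0 u p → IsLerayHopfOn T ν 0 (u 0) u →
    HasRapidSpatialDecay (u 0) → HasSmoothExtensionPast ν 0 u T →
    ∃ M : ℝ, ∀ t ∈ Ico 0 T, ∀ (R : E3 ≃ₗᵢ[ℝ] E3) (c : ℝ), pflux (u t) R c ≤ ENNReal.ofReal M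

/-- D5 piece 2: the crux AT A BLOW-UP TIME — all the content (a costume of the crux, recorded only
to make the point that D5 isolates nothing). -/
def BlowupFlux : Prop :=
  ∀ (ν T : ℝ), 0 < ν → 0 < T → ∀ (u : ℝ → E3 → E3) (p : ℝ → E3 → ℝ),
    IsClassicalNSSolutionOn (Ico 0 T) ν 0 u p → IsLerayHopfOn T ν 0 (u 0) u →
    HasRapidSpatialDecay (u 0) → ¬ HasSmoothExtensionPast ν 0 u T →
    ∃ M : ℝ, ∀ t ∈ Ico 0 T, ∀ (R : E3 ≃ₗᵢ[ℝ] E3) (c : ℝ), pflux (u t) R c ≤ ENNReal.ofReal M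

/-- D5 glue (case split on smooth extension past `T`). -/
theorem planarFluxAPriori_of_lifespanSplit (h₁ : NoBlowupFlux) (h₂ : BlowupFlux) :
    Theses.SlicedKelvin.PlanarFluxAPriori := by
  intro ν T hν hT u p hcl hLH hdec
  by_cases hext : HasSmoothExtensionPast ν 0 u T
  · exact h₁ ν T hν hT u p hcl hLH hdec hext
  · exact h₂ ν T hν hT u p hcl hLH hdec hext

/-! ## §4 The lead's nodal reshape of `stub_foldCreationBudget`, typed (D7) -/

/-- The registered Duhamel fold-creation functional `D(u;R,t)` of line `birth` (verbatim the
`liminf` of `stub_foldCreationBudget`, density = `Theorems.SlicedKelvin.foldDensity`). -/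
def duhamelFold (ν : ℝ) (u : ℝ → E3 → E3) (R : E3 ≃ₗᵢ[ℝ] E3) (t : ℝ) : ℝ≥0∞ :=
  Filter.liminf (fun ε : ℝ => ∫⁻ τ in Ioo 0 t, ENNReal.ofReal (1 / Real.sqrt (ν * (t - τ))) *
    (∫⁻ x : E3, ENNReal.ofReal (Theorems.SlicedKelvin.foldDensity (u τ) R ε x))) (𝓝[>] 0)

/-- `FoldCreationBudget` (= the statement of the open stub `stub_foldCreationBudget`, with the
density abbreviated). -/
def FoldCreationBudget : Prop :=
  ∀ (ν T : ℝ), 0 < ν → 0 < T → ∀ (u : ℝ → E3 → E3) (p : ℝ → E3 → ℝ),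
    IsClassicalNSSolutionOn (Ico 0 T) ν 0 u p → IsLerayHopfOn T ν 0 (u 0) u →
    HasRapidSpatialDecay (u 0) →
    ∃ B : NNReal, ∀ (R : E3 ≃ₗᵢ[ℝ] E3), ∀ t ∈ Ico 0 T, duhamelFold ν u R t ≤ (B : ℝ≥0∞)

/-- `FoldCreationBudget → crux` is LANDED (`planarFluxAPriori_of_foldCreationBudget`, p157376);
re-derived here through the abbreviation (definitional unfolding only). -/
theorem planarFluxAPriori_of_foldCreationBudget' (h : FoldCreationBudget) :
    Theses.SlicedKelvin.PlanarFluxAPriori :=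
  Theorems.SlicedKelvinPlanarFluxAPriori.planarFluxAPriori_of_foldCreationBudget h

/-- The de-regularised NODAL CREATION RATE `Σ₀(v;R) = ∫_{Z} (⟪v,n⟫ · Df[curl v]/‖Df‖)⁻ dℋ²`,
`f = ⟪curl v, n⟫`, `Z = {f = 0}` (the fold surface of the vortex lines w.r.t. the height `⟪x,n⟫`;
lead's STUB3-ANALYSIS (★), factor 2 kept outside). -/
def nodalCreation (v : E3 → E3) (R : E3 ≃ₗᵢ[ℝ] E3) : ℝ≥0∞ :=
  ∫⁻ x in {x : E3 | inner ℝ (curl v x) (R (EuclideanSpace.single 2 1)) = 0},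
    ENNReal.ofReal (max (-(inner ℝ (v x) (R (EuclideanSpace.single 2 1)) *
      (fderiv ℝ (fun z => inner ℝ (curl v z) (R (EuclideanSpace.single 2 1))) x (curl v x)) /
      ‖fderiv ℝ (fun z => inner ℝ (curl v z) (R (EuclideanSpace.single 2 1))) x‖)) 0) ∂μH[2]

/-- D7 piece (a) — DE-REGULARISATION (coarea `ε → 0⁺` on the moving nodal surfaces + vanishing of
the ε-term, needs level-set regularity of `curl u(τ)·n` for a.e. `τ` and `∇u(τ) ∈ L¹(ℝ³)`;
GMT, not in Mathlib): `D(u;R,t) ≤ ∫₀ᵗ (ν(t−τ))^{-1/2} · 2Σ₀(u(τ);R) dτ`. -/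
def Deregularisation : Prop :=
  ∀ (ν T : ℝ), 0 < ν → 0 < T → ∀ (u : ℝ → E3 → E3) (p : ℝ → E3 → ℝ),
    IsClassicalNSSolutionOn (Ico 0 T) ν 0 u p → IsLerayHopfOn T ν 0 (u 0) u →
    HasRapidSpatialDecay (u 0) → ∀ (R : E3 ≃ₗᵢ[ℝ] E3), ∀ t ∈ Ico 0 T,
    duhamelFold ν u R t ≤
      ∫⁻ τ in Ioo 0 t, ENNReal.ofReal (1 / Real.sqrt (ν * (t - τ))) * (2 * nodalCreation (u τ) R)

/-- D7 piece (b) — NODAL BUDGET: the de-regularised fold-creation functional is bounded along the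
solution, uniformly in frames and `t < T`. This piece remains the WHOLE crux (critical, `L^{2,1}_t`). -/
def NodalBudget : Prop :=
  ∀ (ν T : ℝ), 0 < ν → 0 < T → ∀ (u : ℝ → E3 → E3) (p : ℝ → E3 → ℝ),
    IsClassicalNSSolutionOn (Ico 0 T) ν 0 u p → IsLerayHopfOn T ν 0 (u 0) u →
    HasRapidSpatialDecay (u 0) → ∃ B : NNReal, ∀ (R : E3 ≃ₗᵢ[ℝ] E3), ∀ t ∈ Ico 0 T,
    ∫⁻ τ in Ioo 0 t, ENNReal.ofReal (1 / Real.sqrt (ν * (t - τ))) * (2 * nodalCreation (u τ) R)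
      ≤ (B : ℝ≥0∞)

/-- D7 glue: (a) + (b) ⇒ `FoldCreationBudget` (hence the crux, by the landed reduction). -/
theorem foldCreationBudget_of_nodalSplit (ha : Deregularisation) (hb : NodalBudget) :
    FoldCreationBudget := by
  intro ν T hν hT u p hcl hLH hdec
  obtain ⟨B, hB⟩ := hb ν T hν hT u p hcl hLH hdec
  exact ⟨B, fun R t ht => (ha ν T hν hT u p hcl hLH hdec R t ht).trans (hB R t ht)⟩

/-- D7 end to end: the reshaped line would conclude the crux by name. -/
theorem planarFluxAPriori_of_nodalSplit (ha : Deregularisation) (hb : NodalBudget) :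
    Theses.SlicedKelvin.PlanarFluxAPriori :=
  planarFluxAPriori_of_foldCreationBudget' (foldCreationBudget_of_nodalSplit ha hb)

/-! ## §5 Negation side: what `¬crux` must produce, and where D6's Type-I piece lands -/

/-- The object a counterexample produces in the Morrey-bounded branch (after the vorticity-record
zoom at bounded density): a NON-CONSTANT bounded ancient mild solution with bounded Giga–Miyakawa
density. -/
def NonconstantAncientWithBoundedDensity : Prop :=
  ∃ (v : ℝ → E3 → E3) (𝔐 : ℝ), IsBoundedAncientMildSolution 1 v ∧
    (∀ t < 0, AEStronglyMeasurable (v t) volume) ∧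
    ContDiffOn ℝ (⊤ : ℕ∞) (Function.uncurry v) (Iio 0 ×ˢ univ) ∧
    (∀ t < 0, ∀ (x : E3) (r : ℝ), 0 < r →
      ∫⁻ y in Metric.ball x r, ‖curl (v t) y‖ₑ ≤ ENNReal.ofReal (𝔐 * r)) ∧
    ∃ t < 0, ¬ ∃ b : E3, ∀ x, v t x = b

/-- `(L_G)` — Liouville at bounded Giga–Miyakawa density (card circulation-density-liouville):
no such object exists. STRONGER than the route's crux 3 `PlanarFluxLiouville` (whose hypothesis,
bounded planar flux, implies bounded density by `FluxBoundsMorrey`). -/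
def LiouvilleG : Prop := ¬ NonconstantAncientWithBoundedDensity

/-- `(R_G)` — the vorticity-record zoom AT BOUNDED DENSITY (the landed `FluxZoom`,
`Theorems.slicedKelvin_fluxZoom_proof`, with the density `G ≤ 𝔐` in place of the flux bound; the
velocity bound `‖u‖²_∞ ≤ (2/π)‖ω‖_∞ G` is the step `stub_fluxVelocity` already isolates). -/
def GZoom : Prop :=
  ∀ (ν T : ℝ), 0 < ν → 0 < T → ∀ (u : ℝ → E3 → E3) (p : ℝ → E3 → ℝ),
    IsClassicalNSSolutionOn (Ico 0 T) ν 0 u p → IsLerayHopfOn T ν 0 (u 0) u →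
    HasRapidSpatialDecay (u 0) → ¬ HasSmoothExtensionPast ν 0 u T →
    (∃ 𝔐 : ℝ, MorreyBoundOn T u 𝔐) → NonconstantAncientWithBoundedDensity

/-- REDUCTION of D6's second piece: `TypeIFluxBound ⇐ NoBlowupFlux + (R_G) + (L_G)`. So the rate
split turns the route into (no Type-II, Morrey) ∧ (L_G) — the thesis of card
circulation-density-liouville plus the shared Type-II exclusion — and the fold law plays no role. -/
theorem typeIFluxBound_of_liouvilleG (h₀ : NoBlowupFlux) (hR : GZoom) (hL : LiouvilleG) :
    TypeIFluxBound := by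
  intro ν T hν hT u p hcl hLH hdec hM
  by_cases hext : HasSmoothExtensionPast ν 0 u T
  · exact h₀ ν T hν hT u p hcl hLH hdec hext
  · exact absurd (hR ν T hν hT u p hcl hLH hdec hext hM) hL

/-- … and therefore the whole crux from (no Type-II, Morrey) + (R_G) + (L_G) + the no-blow-up case. -/
theorem planarFluxAPriori_of_noTypeII_liouvilleG (h₁ : MorreyTypeI) (h₀ : NoBlowupFlux)
    (hR : GZoom) (hL : LiouvilleG) : Theses.SlicedKelvin.PlanarFluxAPriori :=
  planarFluxAPriori_of_rateSplit h₁ (typeIFluxBound_of_liouvilleG h₀ hR hL)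

/-! ## §6 Strengthenings (typed where the vocabulary exists) -/

/-- S-a — UNIFORM-IN-DATA flux bound (= route support `FluxDataBound`, stmt-15602, by `Iff.rfl`). -/
example : Theses.SlicedKelvin.FluxDataBound ↔
    ∀ (ν T A : ℝ), 0 < ν → 0 < T → ∃ M : ℝ, ∀ (u : ℝ → E3 → E3) (p : ℝ → E3 → ℝ),
      IsClassicalNSSolutionOn (Ico 0 T) ν 0 u p → IsLerayHopfOn T ν 0 (u 0) u →
      HasRapidSpatialDecay (u 0) → (∫⁻ x, ‖u 0 x‖ₑ ^ 2 ≤ ENNReal.ofReal A) →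
      (∫⁻ x, ‖curl (u 0) x‖ₑ ≤ ENNReal.ofReal A) →
      (∀ (R : E3 ≃ₗᵢ[ℝ] E3) (c : ℝ), pflux (u 0) R c ≤ ENNReal.ofReal A) →
      ∀ t ∈ Ico 0 T, ∀ (R : E3 ≃ₗᵢ[ℝ] E3) (c : ℝ), pflux (u t) R c ≤ ENNReal.ofReal M :=
  Iff.rfl

/-- S-c — MONOTONE SUP-FLUX (the most rigid form: `sup_{R,c} Φ` non-increasing in `t`). False
numerically (card kit j004756: `Φ*` ×1.5–2); recorded as the strengthening that would admit a
one-line induction in time. -/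
def MonotoneSupFlux : Prop :=
  ∀ (ν T : ℝ), 0 < ν → 0 < T → ∀ (u : ℝ → E3 → E3) (p : ℝ → E3 → ℝ),
    IsClassicalNSSolutionOn (Ico 0 T) ν 0 u p → IsLerayHopfOn T ν 0 (u 0) u →
    HasRapidSpatialDecay (u 0) → ∀ s ∈ Ico 0 T, ∀ t ∈ Ico 0 T, s ≤ t →
    (⨆ R : E3 ≃ₗᵢ[ℝ] E3, ⨆ c : ℝ, pflux (u t) R c) ≤ ⨆ R : E3 ≃ₗᵢ[ℝ] E3, ⨆ c : ℝ, pflux (u s) R c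

/-- S-c ⇒ crux needs only the initial bound (landed `stub_initialFluxFinite`): typed glue. -/
theorem planarFluxAPriori_of_monotone (h : MonotoneSupFlux) :
    Theses.SlicedKelvin.PlanarFluxAPriori := by
  intro ν T hν hT u p hcl hLH hdec
  obtain ⟨A, hA⟩ :=
    Theorems.SlicedKelvinPlanarFluxAPriori.stub_initialFluxFinite (u 0) hdec
  refine ⟨(A : ℝ), fun t ht R c => ?_⟩
  have h0 : (0 : ℝ) ∈ Ico 0 T := ⟨le_rfl, hT⟩
  calc pflux (u t) R c ≤ ⨆ R : E3 ≃ₗᵢ[ℝ] E3, ⨆ c : ℝ, pflux (u t) R c :=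
        le_iSup_of_le R (le_iSup (fun c => pflux (u t) R c) c)
    _ ≤ ⨆ R : E3 ≃ₗᵢ[ℝ] E3, ⨆ c : ℝ, pflux (u 0) R c := h ν T hν hT u p hcl hLH hdec 0 h0 t ht ht.1
    _ ≤ (A : ℝ≥0∞) := iSup_le fun R' => iSup_le fun c' => hA R' c'
    _ = ENNReal.ofReal (A : ℝ) := (ENNReal.ofReal_coe_nnreal).symm

end Summit.NavierStokesRegularity.NavierStokesRegularity.Cruxes.PlanarFluxAPriori.StrategistS2

end
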